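import Literature.Claims.NS.Chae2007
import HarnessLib

/-!
# Claim skeleton (D-0090 NS-CLAIMS, C78): Chae, arXiv:math/0504219v1 (2005, withdrawn the next day) —
# «Note on the finite time singularities for the 3D Navier-Stokes equations» (conditional enstrophy blow-up)

Typed skeleton of D. Chae, *Note on the finite time singularities for the 3D Navier-Stokes equations*,
arXiv:math/0504219 **v1** [math.AP], 11 Apr 2005, 9 pp. (text of record; bib `Chae2005FiniteTimeSingularitiesWithdrawn`;
TeX + page renders in `run/shared/lean/pub/ns-claims/sources/Chae2005/`). v2 (12 Apr 2005) is the withdrawal notice,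
verbatim: "The paper has been withdrawn by the author due to a gap in Proof of Theorem 1.1" (no locator). UNREFEREED,
WITHDRAWN CLAIM under adjudication — NOTHING here asserts a step: the paper's statements are `def … : Prop`; the theorems
are kernel relations only. `p. N` = v1 PDF page; `(m.n)` = PRINT equation numbers (the TeX labels differ: print
(1.5)/(1.6) = TeX `1.5`/`1.5a`, print (1.7)/(1.8) = TeX `1.6`/`1.7`, print (2.7) = TeX `2.6a`, print (2.9)–(2.17) = TeX
`2.8`–`2.16`; lit-2 LOCATORS.md). The same author's opposite-direction claim of 2007 is C17, `Literature.Claims.NS.Chae2007`,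
whose rendering of "classical solution in `C([0,T); H^m)`" (`Chae2007.IsDatum`, `Chae2007.IsLocalSolution`,
`Chae2007.IsGlobalSolution`: the Beale–Kato–Majda class of the tree) is REUSED here by name.

## The claimed statement (p. 3, Theorem 1.1, verbatim; print numbering)

Setting (p. 2): `(1.1) Dv/Dt = −∇p + νΔv`, `(1.2) div v = 0`, `(1.3) v(x,0) = v₀(x)`, `ν ≥ 0` ("`ν = 0` corresponds to
the Euler equations"), `Ω ∈ {𝕋³, ℝ³, bounded}` ("Our results … does not depend on the specific condition on `Ω`, although
we need at least local existence of a classical solution"); `V_ij = ∂ᵢvⱼ`, `S = (V + Vᵀ)/2`, `A = (V − Vᵀ)/2`, `P_ij = ∂ᵢ∂ⱼp`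
(1.4); for "`ω(x,t)` with `‖ω(t)‖_{L²} ≠ 0`" the quotients (p. 3) `σ = ∫S_ij ω_i ω_j/‖ω‖²`, `ρ = ∫P_ij ω_i ω_j/‖ω‖²`,
`α = ∫S_ij ∇ω_i·∇ω_j/‖ω‖²`, `β = ‖Sω‖/‖ω‖`, `δ = ‖∇ω‖/‖ω‖`; `σ₀ = σ(0)` etc.
**Theorem 1.1**: "Let `v₀ ∈ H^m(Ω)`, `m > 5/2`, with `div v₀ = 0` and `‖ω₀‖_{L²} ≠ 0`, `ν ≥ 0`, and `f ∈ C([0,∞); H^m(Ω))`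
with `curl f = 0` be given. Suppose (1.5) `σ₀ > νδ₀²`, and (1.6) `(σ₀ − νδ₀²)² > 2σ₀² + ρ₀ − ν(2α₀ − 6β₀δ₀ + 2νδ₀²)`. Then the
solution of the system (1.1)-(1.3) with the initial data `v₀` blows up in finite time, namely (1.7)
`limsup_{t→T*} ‖ω(t)‖_{L²} = ∞` for some `T* ∈ (0, ∞)`. Moreover, we have an upper estimate of the Blow-up time, (1.8)
`T* ≤ 1/[(σ₀ − νδ₀²) − √({2σ₀² + ρ₀ − ν(2α₀ − 6β₀δ₀ + 2νδ₀²)}₊)]`." — p. 2: "We did not yet find if there exists such data".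
Remark 1.1 (pp. 3–4): (1.9) `σ₀ > 0 ∧ ρ₀ < −σ₀²` ⇒ (1.5), (1.6) for all `ν ∈ [0, ν₀]`, "including the Euler equations".

RENDERING: whole space `Ω = ℝ³` (Δ1: the `𝕋³`/bounded variants are not typed; "does not depend on `Ω`"); NO force (the
force `f` of the theorem's first sentence enters no displayed equation — (1.1) and (2.1)–(2.5) are written without it; a
curl-free `f = ∇φ` is a pressure shift `p ↦ p − φ`, Δ3); data/solutions in the BKM class as in C17 (`Chae2007.IsDatum` ⊇ all
Clay data; `Chae2007.IsLocalSolution ν T v₀ u p`; TODO(general form): `H^m`, `m > 5/2`); the quotients `σ, ρ, α, β, δ` as real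
functions of `t` built from `u t`, `p t` (Bochner/lower integrals; in the class and for `‖ω(t)‖ ≠ 0` no junk value is met).
The pressure Hessian `P` is that of the solution's own pressure `p` (p. 2). Time derivatives of the scalar functions
`‖ω(t)‖, Ψ(t), …` are RIGHT derivatives on `[0,T)` (`HasDerivWithinAt _ _ (Ici t) t`), so that no value of `u` at negative
times (junk) is involved; "blows up" (1.7)–(1.8) is rendered on THE solution = the maximal classical solution from `v₀`
(`IsMaximal`): no global solution in the class, lifespan `T* ≤ 1/κ`, and `‖ω(t)‖_{L²}` unbounded on `[0,T*)`.

## Clay delta (reference `Literature.Claims.NS.ClayVariants`)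

Nearest Clay statement: (C) (breakdown on `ℝ³`) for `ν > 0` — but the printed theorem is CONDITIONAL on the data class
(1.5)∧(1.6), whose non-emptiness the paper leaves open (p. 2) ⇒ Δ6/Δ4: a criterion-shaped statement; (C) at `ν` would
follow only from a Clay datum IN the class (`ClayVariants.clayR3.BreakdownAt ν` needs, in addition, the summit-side bridge
"Clay (A)-solutions from Clay data lie in the BKM class / are unique" — `navierStokesRegularity_iff_noBlowup` — which a
Literature file cannot import: recorded, not typed); Δ2: `ν = 0` (Euler) included; Δ7: every `ν ≥ 0` for which the datum
satisfies (1.5)–(1.6) (Remark 1.1: all small `ν`). No `clay_of_claimed` is stated.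

## ORDERED STEP INDEX (print order = dependency order; `claim_of_steps` consumes Steps 2–12; Step 1 is the setting)

* `Step_1` (p. 2 "we need at least local existence of a classical solution"; p. 8 "if the classical solution survives until
  `T*`"): local existence with a maximal solution, rendered as in C17 (`Chae2007.Step_1`-type dichotomy). Classical + cite.
* `Step_2` (p. 3, standing assumption "Given `ω(x,t)` with `‖ω(t)‖_{L²} ≠ 0`, we introduce the functions …", used throughout
  §2 with `Ψ = 1/‖ω‖`): IMPLICIT — along a classical solution with `ω₀ ≢ 0`, `‖ω(t)‖_{L²} ≠ 0` for all `t`. (True: Euler by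
  reversibility + uniqueness; NS by backward uniqueness.)
* `Step_3` (p. 5, (2.8)–(2.9) [TeX 2.7–2.8]: `½ d/dt‖ω‖² = (σ − νδ²)‖ω‖²`, `d‖ω‖/dt = (σ − νδ²)‖ω‖ ≤ σ‖ω‖`), with the
  regularity the section uses (continuity in `t` of the quotients) and the Cauchy–Schwarz fact `|σ|‖ω‖ ≤ ‖Sω‖` quoted on p. 6.
* `Step_4` (p. 5, (2.10) [TeX 2.8a]: "`d/dt ‖∇ω‖² = −2Σ∫S_ij ω_j Δω_i − 2ν‖Δω‖²`", AS PRINTED — the convective contribution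
  `−2Σᵢ∫(∇ωᵢ)·S(∇ωᵢ)` of `(v·∇)` does not appear; used on p. 5–6 multiplied by `ν`).
* `Step_5` (pp. 5–6, (2.11) [TeX 2.9] up to its penultimate line: from (2.3), (2.5) AND (2.10),
  `½ d²/dt²‖ω‖² = ‖Sω‖² − ∫P_ij ω_i ω_j + 6ν∫S_ij Δω_i ω_j + 2ν∫S_ij∇ω_i·∇ω_j + 2ν²‖Δω‖² ≥ ‖Sω‖² + (−ρ + 2να)‖ω‖² −
  6ν‖Sω‖‖Δω‖ + 2ν²‖Δω‖²`), typed as the implication "(2.10) for this solution ⇒ (2.11)-penultimate", with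
  `½(‖ω‖²)″ = ‖ω‖″‖ω‖ + (‖ω‖′)²`.
* `Step_6` (p. 6, LAST «≥» of (2.11): "≥ (σ² − ρ + 2να − 6νβδ + 2ν²δ²)‖ω‖², where we used the inequality
  `‖Sω‖ ≥ ∫|ω·Sω|/‖ω‖ ≥ σ‖ω‖` in the last inequality") — ABSTRACT GRAIN (F15): the real-number inference with `β‖ω‖ = ‖Sω‖`,
  `δ‖ω‖ = ‖∇ω‖` (p. 3) — it replaces `‖Δω‖` by `‖∇ω‖` in two terms; absent at `ν = 0`.
* `Step_7` (p. 6, display after (2.11): "`(‖ω‖²)″ = 2‖ω‖″‖ω‖ + 2(‖ω‖′)² ≤ 2‖ω‖″‖ω‖ + 2σ²‖ω‖²`, where we used (2.9)") —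
  ABSTRACT GRAIN: from `‖ω‖′ = (σ − νδ²)‖ω‖` infer `(‖ω‖′)² ≤ σ²‖ω‖²`; absent at `ν = 0`.
* `Step_8` (p. 6, (2.12) [TeX 2.10] `‖ω‖″ ≥ (−ρ + 2να − 6νβδ + 2ν²δ²)‖ω‖`, the computation
  `Ψ″ = −‖ω‖″/‖ω‖² + 2(‖ω‖′)²/‖ω‖³ ≤ … = (2σ² + ρ − 2να + 6νβδ − 2ν²δ²)Ψ` = Prop 2.1 (2.6)–(2.7), and (2.13) [TeX 2.12]
  `Ψ″ − h²Ψ ≤ 0`, `h = √(g₊)`) — abstract real-function grain; calculus + arithmetic, true.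
* `Step_9` (p. 7, the display after (2.13): "We multiply (2.13) by `exp(∫₀ᵗ h ds)`. Then
  `d²/dt²[Ψ exp(∫₀ᵗh)] − 2h d/dt[Ψ exp(∫₀ᵗh)] ≤ 0`") — ABSTRACT GRAIN: for time-dependent `h` the left side equals
  `(Ψ″ − h²Ψ + h′Ψ)e^{∫h}`; the `h′Ψ` term is not mentioned (lit-2 L3). Present for every `ν ≥ 0`, Euler included.
* `Step_10` (p. 7, (2.14)→(2.15) [TeX 2.13–2.14]: "Multiplying by `exp(−2∫h)` … (2.14) is easily integrable to yield (2.15)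
  `Ψ ≤ [Ψ₀ + (h₀Ψ₀ + Ψ₀′)∫₀ᵗexp(2∫₀^τ h)dτ] exp(−∫₀ᵗ h)`" + "the obvious estimates `exp(∫h) ≥ 1`, `∫₀ᵗexp(2∫h) ≥ t`, which
  follow from `h ≥ 0`") — abstract real-function grain, true.
* `Step_11` (pp. 7–8, (2.16)–(2.17) [TeX 2.15–2.16]: `Ψ₀′ = −(σ₀ − νδ₀²)Ψ₀`; "(1.5)-(1.6) are equivalent to
  `σ₀ − νδ₀² − h₀ > 0`"; `‖ω(t)‖ ≥ ‖ω₀‖e^{∫h}/(1 − [σ₀ − νδ₀² − h₀]∫₀ᵗe^{2∫h}) ≥ ‖ω₀‖/(1 − [σ₀ − νδ₀² − h₀]t)`) — arithmetic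
  grain, true (`Step_11_equiv` + `Step_11`).
* `Step_12` (p. 8: "`‖ω(t)‖ ↗ ∞` as `t ↗ T* := 1/(σ₀ − νδ₀² − h₀)`, if the classical solution survives until `T*`, and we have
  proved (1.7)") — the closing inference INCLUDING the case the text does not treat (the solution ceasing to be classical
  BEFORE `1/κ`: there (1.7) needs "finite lifespan ⇒ `limsup‖ω‖_{L²} = ∞`", a continuation criterion true for `ν > 0`
  (tree: `hasSobolevExtensionPast_of_uniform_H1_bound` + energy) and not known for `ν = 0`) — IMPLICIT step.
* `Step_5E` (rev 2): (2.11) at `ν = 0` WITHOUT (2.10) — the Euler conjunct composes from Steps 2, 3, 5E, 6–12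
  (`claim_of_steps_euler`), so its dependency set does not contain `Step_4`.
* HEADLINE `ClaimedTheorem` (Theorem 1.1 with (1.7)–(1.8)); `claim_of_steps : Step_2 → … → Step_12 → ClaimedTheorem` PROVED
  (pure logic; the lower bound `lowerBound_of_steps` is run on every solution piece; `Step_1` is the setting and is not
  consumed once `Step_12` is granted).

COMPOSITION: proved as `claim_of_steps`. Locator candidates recorded by the lit seat (LOCATORS L1–L4) are typed as separate
Steps: L1 = `Step_6`, L2 = `Step_7` (both vanish at `ν = 0`), L3 = `Step_9` (all `ν`), L4 = `Step_12`; (2.10)'s missing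
convective term = `Step_4`. Nothing is asserted; adjudication is the refuter's/referee's.

WHAT THIS IS NOT: not a claim about NS regularity or blow-up; not a claim about any author beyond the typed locator.
-/

noncomputable section

open Set Function Filter MeasureTheory
open scoped Topology ENNReal NNReal ContDiff Laplacian InnerProductSpace RealInnerProductSpace

namespace Literature.Claims.NS.Chae2005

open Literature.Analysis.FluidPDE
open Literature.Claims.NS.Chae2007 (IsDatum IsLocalSolution IsGlobalSolution)

/-! ### Vocabulary (pp. 2–3, 5) -/

/-- `‖f‖_{L²(ℝ³)}` as a real number (square root of the real part of the lower integral); no junk in the class.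
[cite: Chae2005FiniteTimeSingularitiesWithdrawn, §1 p.3] -/
def l2 (f : EuclideanSpace ℝ (Fin 3) → EuclideanSpace ℝ (Fin 3)) : ℝ :=
  Real.sqrt ((∫⁻ x, ‖f x‖ₑ ^ 2).toReal)

/-- The standard basis vector `eₖ` of `ℝ³`. [folklore] -/
def basisVec (k : Fin 3) : EuclideanSpace ℝ (Fin 3) :=
  EuclideanSpace.single k 1

/-- The deformation tensor `S = ½(V + Vᵀ)`, `V_ij = ∂ᵢvⱼ` (p. 2), as the symmetric part of the Fréchet derivative
`Dv(x)` acting on vectors: `S(x)w = ½(Dv(x)w + Dv(x)ᵀw)`. [cite: Chae2005FiniteTimeSingularitiesWithdrawn, §1 p.2] -/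
def strain (v : EuclideanSpace ℝ (Fin 3) → EuclideanSpace ℝ (Fin 3)) (x : EuclideanSpace ℝ (Fin 3))
    (w : EuclideanSpace ℝ (Fin 3)) : EuclideanSpace ℝ (Fin 3) :=
  (1 / 2 : ℝ) • (fderiv ℝ v x w + ContinuousLinearMap.adjoint (fderiv ℝ v x) w)

/-- `‖ω(t)‖_{L²}`, `ω = curl v` (p. 3). [cite: Chae2005FiniteTimeSingularitiesWithdrawn, §1 p.3] -/
def wNorm (u : ℝ → EuclideanSpace ℝ (Fin 3) → EuclideanSpace ℝ (Fin 3)) (t : ℝ) : ℝ :=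
  l2 (curl (u t))

/-- `‖Sω‖_{L²}` at time `t` (p. 3, numerator of `β`). [cite: Chae2005FiniteTimeSingularitiesWithdrawn, §1 p.3] -/
def sωNorm (u : ℝ → EuclideanSpace ℝ (Fin 3) → EuclideanSpace ℝ (Fin 3)) (t : ℝ) : ℝ :=
  l2 (fun x => strain (u t) x (curl (u t) x))

/-- `‖∇ω‖_{L²}` at time `t` (p. 3, numerator of `δ`): `(∫ Σₖ |∂ₖω|²)^{1/2}` (Frobenius norm of `Dω`).
[cite: Chae2005FiniteTimeSingularitiesWithdrawn, §1 p.3] -/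
def gradVortNorm (u : ℝ → EuclideanSpace ℝ (Fin 3) → EuclideanSpace ℝ (Fin 3)) (t : ℝ) : ℝ :=
  Real.sqrt ((∫⁻ x, ENNReal.ofReal (frobeniusNormSq (fderiv ℝ (curl (u t)) x))).toReal)

/-- `‖Δω‖_{L²}` at time `t` (pp. 5–6, in (2.10)–(2.11)). [cite: Chae2005FiniteTimeSingularitiesWithdrawn, §2 p.5] -/
def lapVortNorm (u : ℝ → EuclideanSpace ℝ (Fin 3) → EuclideanSpace ℝ (Fin 3)) (t : ℝ) : ℝ :=
  l2 (fun x => (Δ (curl (u t))) x)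

/-- `σ(t) = Σ∫ S_ij ω_i ω_j dx / ‖ω‖²` (p. 3); `Σ S_ij ω_i ω_j = ω·Dv(x)ω` (the antisymmetric part drops out of the
quadratic form). [cite: Chae2005FiniteTimeSingularitiesWithdrawn, §1 p.3] -/
def sigmaQ (u : ℝ → EuclideanSpace ℝ (Fin 3) → EuclideanSpace ℝ (Fin 3)) (t : ℝ) : ℝ :=
  (∫ x, ⟪curl (u t) x, fderiv ℝ (u t) x (curl (u t) x)⟫_ℝ) / wNorm u t ^ 2

/-- `ρ(t) = Σ∫ P_ij ω_i ω_j dx / ‖ω‖²`, `P_ij = ∂ᵢ∂ⱼp` the Hessian of the solution's pressure (pp. 2–3).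
[cite: Chae2005FiniteTimeSingularitiesWithdrawn, §1 p.3] -/
def rhoQ (u : ℝ → EuclideanSpace ℝ (Fin 3) → EuclideanSpace ℝ (Fin 3)) (p : ℝ → EuclideanSpace ℝ (Fin 3) → ℝ)
    (t : ℝ) : ℝ :=
  (∫ x, iteratedFDeriv ℝ 2 (p t) x ![curl (u t) x, curl (u t) x]) / wNorm u t ^ 2

/-- `α(t) = Σ∫ S_ij ∇ω_i·∇ω_j dx / ‖ω‖² = ∫ Σₖ ∂ₖω·S∂ₖω / ‖ω‖²` (p. 3). [cite: Chae2005FiniteTimeSingularitiesWithdrawn, §1 p.3] -/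
def alphaQ (u : ℝ → EuclideanSpace ℝ (Fin 3) → EuclideanSpace ℝ (Fin 3)) (t : ℝ) : ℝ :=
  (∫ x, ∑ k : Fin 3, ⟪fderiv ℝ (curl (u t)) x (basisVec k),
      strain (u t) x (fderiv ℝ (curl (u t)) x (basisVec k))⟫_ℝ) / wNorm u t ^ 2

/-- `β(t) = ‖Sω‖_{L²}/‖ω‖_{L²}` (p. 3). [cite: Chae2005FiniteTimeSingularitiesWithdrawn, §1 p.3] -/
def betaQ (u : ℝ → EuclideanSpace ℝ (Fin 3) → EuclideanSpace ℝ (Fin 3)) (t : ℝ) : ℝ :=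
  sωNorm u t / wNorm u t

/-- `δ(t) = ‖∇ω‖_{L²}/‖ω‖_{L²}` (p. 3). [cite: Chae2005FiniteTimeSingularitiesWithdrawn, §1 p.3] -/
def deltaQ (u : ℝ → EuclideanSpace ℝ (Fin 3) → EuclideanSpace ℝ (Fin 3)) (t : ℝ) : ℝ :=
  gradVortNorm u t / wNorm u t

/-- `g(t) = 2σ² + ρ − ν(2α − 6βδ + 2νδ²)` — (2.7) [TeX 2.6a], the coefficient of Proposition 2.1 (p. 5).
[cite: Chae2005FiniteTimeSingularitiesWithdrawn, Prop. 2.1 (2.7) p.5] -/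
def gFun (ν : ℝ) (u : ℝ → EuclideanSpace ℝ (Fin 3) → EuclideanSpace ℝ (Fin 3))
    (p : ℝ → EuclideanSpace ℝ (Fin 3) → ℝ) (t : ℝ) : ℝ :=
  2 * sigmaQ u t ^ 2 + rhoQ u p t - ν * (2 * alphaQ u t - 6 * betaQ u t * deltaQ u t + 2 * ν * deltaQ u t ^ 2)

/-- Hypothesis (1.5) (p. 3): `σ₀ > νδ₀²`, written `0 < σ₀ − νδ₀²`. [cite: Chae2005FiniteTimeSingularitiesWithdrawn, Thm 1.1 (1.5) p.3] -/
def Cond15 (ν : ℝ) (u : ℝ → EuclideanSpace ℝ (Fin 3) → EuclideanSpace ℝ (Fin 3)) : Prop :=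
  0 < sigmaQ u 0 - ν * deltaQ u 0 ^ 2

/-- Hypothesis (1.6) (p. 3): `(σ₀ − νδ₀²)² > 2σ₀² + ρ₀ − ν(2α₀ − 6β₀δ₀ + 2νδ₀²) = g(0)`.
[cite: Chae2005FiniteTimeSingularitiesWithdrawn, Thm 1.1 (1.6) p.3] -/
def Cond16 (ν : ℝ) (u : ℝ → EuclideanSpace ℝ (Fin 3) → EuclideanSpace ℝ (Fin 3))
    (p : ℝ → EuclideanSpace ℝ (Fin 3) → ℝ) : Prop :=
  gFun ν u p 0 < (sigmaQ u 0 - ν * deltaQ u 0 ^ 2) ^ 2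

/-- `κ := (σ₀ − νδ₀²) − √(g(0)₊)` — the reciprocal of the printed bound (1.8) on the blow-up time, `T* ≤ 1/κ` (p. 3; p. 8
`T* = 1/(σ₀ − νδ₀² − h₀)`, `h₀ = √(g₊(0))`). [cite: Chae2005FiniteTimeSingularitiesWithdrawn, Thm 1.1 (1.8) p.3] -/
def kappa (ν : ℝ) (u : ℝ → EuclideanSpace ℝ (Fin 3) → EuclideanSpace ℝ (Fin 3))
    (p : ℝ → EuclideanSpace ℝ (Fin 3) → ℝ) : ℝ :=
  (sigmaQ u 0 - ν * deltaQ u 0 ^ 2) - Real.sqrt (max (gFun ν u p 0) 0)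

/-- "The solution" of Theorem 1.1 = the maximal classical solution: a solution on `[0,T)` in the class is MAXIMAL if no
solution from the same datum on a longer `[0,T')` extends it (p. 8 "if the classical solution survives until `T*`").
[cite: Chae2005FiniteTimeSingularitiesWithdrawn, §1 p.2 and p.8] -/
def IsMaximal (ν T : ℝ) (v₀ : EuclideanSpace ℝ (Fin 3) → EuclideanSpace ℝ (Fin 3))
    (u : ℝ → EuclideanSpace ℝ (Fin 3) → EuclideanSpace ℝ (Fin 3)) (_p : ℝ → EuclideanSpace ℝ (Fin 3) → ℝ) : Prop :=
  ¬ ∃ (T' : ℝ) (u' : ℝ → EuclideanSpace ℝ (Fin 3) → EuclideanSpace ℝ (Fin 3)) (p' : ℝ → EuclideanSpace ℝ (Fin 3) → ℝ),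
    T < T' ∧ IsLocalSolution ν T' v₀ u' p' ∧ ∀ t ∈ Ico 0 T, u' t = u t

/-! ### The claimed theorem (p. 3) -/

/-- **HEADLINE — Theorem 1.1 (p. 3) with (1.7)–(1.8), as printed** (conditional finite-time enstrophy blow-up for
`(NS)_ν`, `ν ≥ 0`): for every `ν ≥ 0` and every datum of the class with `ω₀ ≢ 0`: (a) NO global classical solution in
the class whose initial quotients satisfy (1.5)–(1.6) exists ("blows up in finite time"), and (b) the maximal classical
solution on `[0,T*)` whose initial quotients satisfy (1.5)–(1.6) has `T* ≤ 1/κ` (1.8) and `‖ω(t)‖_{L²}` unbounded on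
`[0,T*)` (1.7). (The quotients at `t = 0` are functions of `v₀` and of the initial pressure Hessian; the curl-free force
of the hypothesis enters no equation of the paper and is not typed.) [claim: Chae2005FiniteTimeSingularitiesWithdrawn, status: disputed] -/
def ClaimedTheorem : Prop :=
  ∀ ν : ℝ, 0 ≤ ν → ∀ v₀ : EuclideanSpace ℝ (Fin 3) → EuclideanSpace ℝ (Fin 3), IsDatum v₀ → l2 (curl v₀) ≠ 0 →
    (∀ (u : ℝ → EuclideanSpace ℝ (Fin 3) → EuclideanSpace ℝ (Fin 3)) (p : ℝ → EuclideanSpace ℝ (Fin 3) → ℝ),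
      IsGlobalSolution ν v₀ u p → Cond15 ν u → Cond16 ν u p → False) ∧
    ∀ T : ℝ, 0 < T →
      ∀ (u : ℝ → EuclideanSpace ℝ (Fin 3) → EuclideanSpace ℝ (Fin 3)) (p : ℝ → EuclideanSpace ℝ (Fin 3) → ℝ),
        IsLocalSolution ν T v₀ u p → IsMaximal ν T v₀ u p → Cond15 ν u → Cond16 ν u p →
          T ≤ 1 / kappa ν u p ∧ ∀ M : ℝ, ∃ t ∈ Ico 0 T, M < wNorm u t

/-- The Navier–Stokes part (`ν > 0`). [claim: Chae2005FiniteTimeSingularitiesWithdrawn, status: disputed] -/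
def ClaimedTheoremNS : Prop :=
  ∀ ν : ℝ, 0 < ν → ∀ v₀ : EuclideanSpace ℝ (Fin 3) → EuclideanSpace ℝ (Fin 3), IsDatum v₀ → l2 (curl v₀) ≠ 0 →
    (∀ (u : ℝ → EuclideanSpace ℝ (Fin 3) → EuclideanSpace ℝ (Fin 3)) (p : ℝ → EuclideanSpace ℝ (Fin 3) → ℝ),
      IsGlobalSolution ν v₀ u p → Cond15 ν u → Cond16 ν u p → False) ∧
    ∀ T : ℝ, 0 < T →
      ∀ (u : ℝ → EuclideanSpace ℝ (Fin 3) → EuclideanSpace ℝ (Fin 3)) (p : ℝ → EuclideanSpace ℝ (Fin 3) → ℝ),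
        IsLocalSolution ν T v₀ u p → IsMaximal ν T v₀ u p → Cond15 ν u → Cond16 ν u p →
          T ≤ 1 / kappa ν u p ∧ ∀ M : ℝ, ∃ t ∈ Ico 0 T, M < wNorm u t

/-- The Euler part (`ν = 0`; Remark 1.1: "including the Euler equations"). At `ν = 0` the `ν`-dependent slips
(`Step_4`, `Step_6`, `Step_7`) disappear and the chain runs through `Step_9`.
[claim: Chae2005FiniteTimeSingularitiesWithdrawn, status: disputed] -/
def ClaimedTheoremEuler : Prop :=
  ∀ v₀ : EuclideanSpace ℝ (Fin 3) → EuclideanSpace ℝ (Fin 3), IsDatum v₀ → l2 (curl v₀) ≠ 0 →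
    (∀ (u : ℝ → EuclideanSpace ℝ (Fin 3) → EuclideanSpace ℝ (Fin 3)) (p : ℝ → EuclideanSpace ℝ (Fin 3) → ℝ),
      IsGlobalSolution 0 v₀ u p → Cond15 0 u → Cond16 0 u p → False) ∧
    ∀ T : ℝ, 0 < T →
      ∀ (u : ℝ → EuclideanSpace ℝ (Fin 3) → EuclideanSpace ℝ (Fin 3)) (p : ℝ → EuclideanSpace ℝ (Fin 3) → ℝ),
        IsLocalSolution 0 T v₀ u p → IsMaximal 0 T v₀ u p → Cond15 0 u → Cond16 0 u p →
          T ≤ 1 / kappa 0 u p ∧ ∀ M : ℝ, ∃ t ∈ Ico 0 T, M < wNorm u t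

/-- Theorem 1.1 = NS part ∧ Euler part. [cite: Chae2005FiniteTimeSingularitiesWithdrawn, Thm 1.1 p.3] -/
theorem claimedTheorem_iff : ClaimedTheorem ↔ ClaimedTheoremNS ∧ ClaimedTheoremEuler := by
  constructor
  · exact fun h => ⟨fun ν hν => h ν hν.le, h 0 le_rfl⟩
  · rintro ⟨hNS, hE⟩ ν hν
    rcases hν.eq_or_lt with h0 | hpos
    · rw [← h0]; exact hE
    · exact hNS ν hpos

/-! ### The paper's steps (no assertion) -/

/-- **Step 1 — the setting (p. 2): "we need at least local existence of a classical solution"** (Kato-type local theory in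
`H^m`, `m > 5/2`, `ν ≥ 0`), rendered as for C17: a datum of the class has a global solution in the class or a maximal one
on some finite `[0,T)`. Classical + cite; not consumed by `claim_of_steps` once `Step_12` is granted.
[cite: Chae2005FiniteTimeSingularitiesWithdrawn, §1 p.2] -/
def Step_1 : Prop :=
  ∀ ν : ℝ, 0 ≤ ν → ∀ v₀ : EuclideanSpace ℝ (Fin 3) → EuclideanSpace ℝ (Fin 3), IsDatum v₀ →
    (∃ (u : ℝ → EuclideanSpace ℝ (Fin 3) → EuclideanSpace ℝ (Fin 3)) (p : ℝ → EuclideanSpace ℝ (Fin 3) → ℝ),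
      IsGlobalSolution ν v₀ u p) ∨
    ∃ T : ℝ, 0 < T ∧
      ∃ (u : ℝ → EuclideanSpace ℝ (Fin 3) → EuclideanSpace ℝ (Fin 3)) (p : ℝ → EuclideanSpace ℝ (Fin 3) → ℝ),
        IsLocalSolution ν T v₀ u p ∧ IsMaximal ν T v₀ u p

/-- **Step 2 — IMPLICIT standing assumption (p. 3): "Given `ω(x,t)` with `‖ω(t)‖_{L²} ≠ 0`, we introduce the functions
`σ, ρ, α, β, δ`"**; §2 divides by `‖ω(t)‖` throughout (`Ψ = 1/‖ω‖`). Typed: along a classical solution in the class with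
`ω₀ ≢ 0`, `‖ω(t)‖_{L²} > 0` for all `t ∈ [0,T)`. (Not printed as a claim; true — Euler: time reversal + uniqueness; NS:
backward uniqueness.) [claim: Chae2005FiniteTimeSingularitiesWithdrawn, status: disputed] -/
def Step_2 : Prop :=
  ∀ ν : ℝ, 0 ≤ ν → ∀ T : ℝ, 0 < T → ∀ (v₀ : EuclideanSpace ℝ (Fin 3) → EuclideanSpace ℝ (Fin 3))
    (u : ℝ → EuclideanSpace ℝ (Fin 3) → EuclideanSpace ℝ (Fin 3)) (p : ℝ → EuclideanSpace ℝ (Fin 3) → ℝ),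
    IsLocalSolution ν T v₀ u p → l2 (curl v₀) ≠ 0 → ∀ t ∈ Ico 0 T, 0 < wNorm u t

/-- **Step 3 — (2.8)–(2.9), p. 5** ("Multiplying (2.5) by `ωᵢ` … `½ d/dt ∫|ω|² = Σ∫S_ij ω_i ω_j − ν∫|∇ω|² = (σ − νδ²)‖ω‖²`,
from which (2.9) `d‖ω‖/dt = (σ − νδ²)‖ω‖ ≤ σ‖ω‖`"), typed with the time derivative as a right derivative on `[0,T)`,
together with the regularity §2 uses tacitly (the quotients are continuous in `t`) and the inequality quoted on p. 6,
"`‖Sω‖ ≥ ∫|ω·Sω|/‖ω‖ ≥ σ‖ω‖`" (Cauchy–Schwarz), in the form `|σ|‖ω‖ ≤ ‖Sω‖`. Classical enstrophy identity.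
[claim: Chae2005FiniteTimeSingularitiesWithdrawn, status: disputed] -/
def Step_3 : Prop :=
  ∀ ν : ℝ, 0 ≤ ν → ∀ T : ℝ, 0 < T → ∀ (v₀ : EuclideanSpace ℝ (Fin 3) → EuclideanSpace ℝ (Fin 3))
    (u : ℝ → EuclideanSpace ℝ (Fin 3) → EuclideanSpace ℝ (Fin 3)) (p : ℝ → EuclideanSpace ℝ (Fin 3) → ℝ),
    IsLocalSolution ν T v₀ u p → (∀ t ∈ Ico 0 T, 0 < wNorm u t) →
      ContinuousOn (wNorm u) (Ico 0 T) ∧ ContinuousOn (gFun ν u p) (Ico 0 T) ∧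
      (∀ t ∈ Ico 0 T, |sigmaQ u t| * wNorm u t ≤ sωNorm u t) ∧
      ∀ t ∈ Ico 0 T, HasDerivWithinAt (wNorm u) ((sigmaQ u t - ν * deltaQ u t ^ 2) * wNorm u t) (Ici t) t

/-- **Step 4 — (2.10), p. 5, AS PRINTED**: "Taking scalar product in `L²(Ω)` the gradient of (2.5) with `∇ω`, and
integrating by part, we obtain (2.10) `d/dt ‖∇ω‖² = 2Σ∫∇ω_i·∇(S_ij ω_j) − 2ν∫|Δω|² = −2Σ∫S_ij ω_j Δω_i − 2ν∫|Δω|²`."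
(The material derivative `D/Dt` of (2.5) contains `(v·∇)`, whose gradient contributes `−2Σᵢ∫(∇ωᵢ)·S(∇ωᵢ)` to
`d/dt‖∇ω‖²`; that term is absent from the print. The identity is used on pp. 5–6 only multiplied by `ν`.)
[claim: Chae2005FiniteTimeSingularitiesWithdrawn, status: disputed] -/
def Step_4 : Prop :=
  ∀ ν : ℝ, 0 ≤ ν → ∀ T : ℝ, 0 < T → ∀ (v₀ : EuclideanSpace ℝ (Fin 3) → EuclideanSpace ℝ (Fin 3))
    (u : ℝ → EuclideanSpace ℝ (Fin 3) → EuclideanSpace ℝ (Fin 3)) (p : ℝ → EuclideanSpace ℝ (Fin 3) → ℝ),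
    IsLocalSolution ν T v₀ u p →
      ∀ t ∈ Ico 0 T, HasDerivWithinAt (fun s => gradVortNorm u s ^ 2)
        (-2 * (∫ x, ⟪(Δ (curl (u t))) x, strain (u t) x (curl (u t) x)⟫_ℝ) - 2 * ν * lapVortNorm u t ^ 2) (Ici t) t

/-- **Step 5 — (2.11), pp. 5–6, up to its penultimate line, FROM (2.3), (2.5) and (2.10)**: "From (2.5) we compute
`½ D²|ω|²/Dt² = …`. Integrating this over `Ω`, and using (2.3), (2.5), and (2.10), and integrating by part, we derive
`½ d²/dt² ∫|ω|² = … = ‖Sω‖² − Σ∫P_ij ω_i ω_j + 6νΣ∫S_ij(Δω_i)ω_j + 2νΣ∫S_ij∇ω_i·∇ω_j + 2ν²‖Δω‖²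
≥ ‖Sω‖² + (−ρ + 2να)‖ω‖² − 6ν‖Sω‖‖Δω‖ + 2ν²‖Δω‖²`". TYPED as the implication "(2.10) holds for this solution ⇒ the
penultimate line of (2.11)", with `½(‖ω‖²)″ = ‖ω‖″‖ω‖ + (‖ω‖′)²` and `‖ω‖′ = (σ − νδ²)‖ω‖` from `Step_3` (second right
derivative of `‖ω(t)‖` packaged as `y2`). [claim: Chae2005FiniteTimeSingularitiesWithdrawn, status: disputed] -/
def Step_5 : Prop :=
  ∀ ν : ℝ, 0 ≤ ν → ∀ T : ℝ, 0 < T → ∀ (v₀ : EuclideanSpace ℝ (Fin 3) → EuclideanSpace ℝ (Fin 3))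
    (u : ℝ → EuclideanSpace ℝ (Fin 3) → EuclideanSpace ℝ (Fin 3)) (p : ℝ → EuclideanSpace ℝ (Fin 3) → ℝ),
    IsLocalSolution ν T v₀ u p → (∀ t ∈ Ico 0 T, 0 < wNorm u t) →
    (∀ t ∈ Ico 0 T, HasDerivWithinAt (fun s => gradVortNorm u s ^ 2)
        (-2 * (∫ x, ⟪(Δ (curl (u t))) x, strain (u t) x (curl (u t) x)⟫_ℝ) - 2 * ν * lapVortNorm u t ^ 2) (Ici t) t) →
    (∀ t ∈ Ico 0 T, HasDerivWithinAt (wNorm u) ((sigmaQ u t - ν * deltaQ u t ^ 2) * wNorm u t) (Ici t) t) →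
      ∃ y2 : ℝ → ℝ, ∀ t ∈ Ico 0 T,
        HasDerivWithinAt (fun s => (sigmaQ u s - ν * deltaQ u s ^ 2) * wNorm u s) (y2 t) (Ici t) t ∧
        sωNorm u t ^ 2 + (-rhoQ u p t + 2 * ν * alphaQ u t) * wNorm u t ^ 2
            - 6 * ν * sωNorm u t * lapVortNorm u t + 2 * ν ^ 2 * lapVortNorm u t ^ 2 ≤
          y2 t * wNorm u t + ((sigmaQ u t - ν * deltaQ u t ^ 2) * wNorm u t) ^ 2

/-- **Step 6 — the LAST inequality of (2.11), p. 6, at the abstract grain (FAILURE-MODES F15)**: "… `≥ ‖Sω‖² +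
(−ρ + 2να)‖ω‖² − 6ν‖Sω‖‖Δω‖ + 2ν²‖Δω‖² ≥ (σ² − ρ + 2να − 6νβδ + 2ν²δ²)‖ω‖²`, where we used the inequality
`‖Sω‖ ≥ ∫|ω·Sω|/‖ω‖ ≥ σ‖ω‖` in the last inequality." With `w = ‖ω‖ > 0`, `B = ‖Sω‖ = βw`, `C = ‖Δω‖`, `D = ‖∇ω‖ = δw`
(p. 3), `r = ρ`, `a = α`: the printed inference from `|σ|w ≤ B` alone. (It trades `‖Δω‖` for `‖∇ω‖` in the two `ν`-terms,
of opposite signs; lit-2 LOCATORS L1; no content at `ν = 0`.) [claim: Chae2005FiniteTimeSingularitiesWithdrawn, status: disputed] -/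
def Step_6 : Prop :=
  ∀ (ν w B C D r a σ : ℝ), 0 ≤ ν → 0 < w → 0 ≤ B → 0 ≤ C → 0 ≤ D → |σ| * w ≤ B →
    (σ ^ 2 - r + 2 * ν * a - 6 * ν * (B / w) * (D / w) + 2 * ν ^ 2 * (D / w) ^ 2) * w ^ 2 ≤
      B ^ 2 + (-r + 2 * ν * a) * w ^ 2 - 6 * ν * B * C + 2 * ν ^ 2 * C ^ 2

/-- **Step 7 — the display after (2.11), p. 6, at the abstract grain (F15)**: "Substituting the estimate
`(‖ω‖²)″ = 2‖ω‖″‖ω‖ + 2(‖ω‖′)² ≤ 2‖ω‖″‖ω‖ + 2σ²‖ω‖²`, where we used (2.9), into (2.11)": the inference from (2.9)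
`‖ω‖′ = (σ − νδ²)‖ω‖` (with `ν ≥ 0`, `δ² ≥ 0`, `‖ω‖ > 0`) to `(‖ω‖′)² ≤ σ²‖ω‖²` (used again in the `Ψ″` computation "using
(2.9) again"). (lit-2 LOCATORS L2; an identity at `ν = 0`.) [claim: Chae2005FiniteTimeSingularitiesWithdrawn, status: disputed] -/
def Step_7 : Prop :=
  ∀ (σ ν d y : ℝ), 0 ≤ ν → 0 ≤ d → 0 < y → ((σ - ν * d) * y) ^ 2 ≤ σ ^ 2 * y ^ 2

/-- **Step 8 — p. 6: (2.12) [TeX 2.10] and the computation of `Ψ″` = Proposition 2.1 (2.6)–(2.7), then (2.13)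
[TeX 2.12]**: "we have (2.12) `‖ω‖″ ≥ (−ρ + 2να − 6νβδ + 2ν²δ²)‖ω‖`. From this estimate, using (2.9) again, we deduce
`Ψ″ = −‖ω‖″/‖ω‖² + 2(‖ω‖′)²/‖ω‖³ ≤ −‖ω‖″/‖ω‖² + 2σ²/‖ω‖ ≤ … = (2σ² + ρ − 2να + 6νβδ − 2ν²δ²)Ψ`" and (p. 7) "setting
`h(t) = √(g₊(t))` … we have from (2.6) (2.13) `Ψ″ − h²Ψ ≤ 0`". TYPED at the abstract real-function grain: for `y > 0`
with right derivatives `y′ = y1`, `y1′ = y2` on `[0,T)`, `y2·y + y1² ≥ G y²` and `y1² ≤ σ²y²` give, for `Ψ = 1/y`, right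
derivatives `Ψ1 = −y1/y²`, `Ψ2`, with `Ψ2 ≤ (3σ² − G)Ψ` and `Ψ2 − (√((3σ² − G)₊))² Ψ ≤ 0` (note `3σ² − G = g` for
`G = σ² − ρ + 2να − 6νβδ + 2ν²δ²`). Calculus + arithmetic; true. [claim: Chae2005FiniteTimeSingularitiesWithdrawn, status: disputed] -/
def Step_8 : Prop :=
  ∀ (T : ℝ) (y y1 y2 G σf : ℝ → ℝ), 0 < T →
    (∀ t ∈ Ico 0 T, 0 < y t ∧ HasDerivWithinAt y (y1 t) (Ici t) t ∧ HasDerivWithinAt y1 (y2 t) (Ici t) t ∧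
      G t * y t ^ 2 ≤ y2 t * y t + y1 t ^ 2 ∧ y1 t ^ 2 ≤ σf t ^ 2 * y t ^ 2) →
    ∃ Ψ1 Ψ2 : ℝ → ℝ, ∀ t ∈ Ico 0 T,
      HasDerivWithinAt (fun s => (y s)⁻¹) (Ψ1 t) (Ici t) t ∧ HasDerivWithinAt Ψ1 (Ψ2 t) (Ici t) t ∧
      Ψ1 t = -y1 t / y t ^ 2 ∧ Ψ2 t ≤ (3 * σf t ^ 2 - G t) * (y t)⁻¹ ∧
      Ψ2 t - Real.sqrt (max (3 * σf t ^ 2 - G t) 0) ^ 2 * (y t)⁻¹ ≤ 0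

/-- **Step 9 — p. 7, the display after (2.13), at the abstract grain (F15)**: "We multiply (2.13) by `exp(∫₀ᵗ h ds)`.
Then, `d²/dt²[Ψ exp(∫₀ᵗ h ds)] − 2h d/dt[Ψ exp(∫₀ᵗ h ds)] ≤ 0`." TYPED: for `h ≥ 0` continuous and `Ψ > 0` with right
derivatives `Ψ1`, `Ψ2` on `[0,T)` satisfying (2.13) `Ψ2 − h²Ψ ≤ 0`, the function `F = Ψ·exp(∫₀ᵗ h)` has right
derivatives `F1`, `F2` on `[0,T)` with `F1(0) = Ψ1(0) + h(0)Ψ(0)`, `F1` continuous, and `F2 − 2h F1 ≤ 0`. (For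
time-dependent `h` the left side equals `(Ψ″ − h²Ψ + h′Ψ)e^{∫h}`: the term `h′Ψ` is not accounted for in the print —
lit-2 LOCATORS L3; present for every `ν ≥ 0`.) [claim: Chae2005FiniteTimeSingularitiesWithdrawn, status: disputed] -/
def Step_9 : Prop :=
  ∀ (T : ℝ) (Ψ Ψ1 Ψ2 h : ℝ → ℝ), 0 < T → ContinuousOn h (Ico 0 T) → (∀ t ∈ Ico 0 T, 0 ≤ h t) →
    (∀ t ∈ Ico 0 T, 0 < Ψ t ∧ HasDerivWithinAt Ψ (Ψ1 t) (Ici t) t ∧ HasDerivWithinAt Ψ1 (Ψ2 t) (Ici t) t ∧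
      Ψ2 t - h t ^ 2 * Ψ t ≤ 0) →
    ∃ F1 F2 : ℝ → ℝ, F1 0 = Ψ1 0 + h 0 * Ψ 0 ∧ ContinuousOn F1 (Ico 0 T) ∧ ∀ t ∈ Ico 0 T,
      HasDerivWithinAt (fun s => Ψ s * Real.exp (∫ τ in (0:ℝ)..s, h τ)) (F1 t) (Ici t) t ∧
      HasDerivWithinAt F1 (F2 t) (Ici t) t ∧ F2 t - 2 * h t * F1 t ≤ 0

/-- **Step 10 — p. 7, (2.14)→(2.15) [TeX 2.13–2.14] and the "obvious estimates"**: "Multiplying this inequality by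
`exp(−2∫₀ᵗ h)`, we obtain (2.14) `d/dt{d/dt[Ψ exp(∫h)] exp(−2∫h)} ≤ 0`. Now (2.14) is easily integrable to yield (2.15)
`Ψ ≤ [Ψ₀ + (h₀Ψ₀ + Ψ₀′)∫₀ᵗexp(2∫₀^τ h ds)dτ] exp(−∫₀ᵗ h ds)`", and (p. 8) "`exp(∫₀ᵗh) ≥ 1` and `∫₀ᵗexp(2∫h)dτ ≥ t`, which
follow from `h ≥ 0`". Abstract real-function grain (right derivatives, `Ψ`, `F1` continuous); true.
[claim: Chae2005FiniteTimeSingularitiesWithdrawn, status: disputed] -/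
def Step_10 : Prop :=
  ∀ (T : ℝ) (Ψ F1 F2 h : ℝ → ℝ) (Ψ1₀ : ℝ), 0 < T → ContinuousOn h (Ico 0 T) → (∀ t ∈ Ico 0 T, 0 ≤ h t) →
    ContinuousOn Ψ (Ico 0 T) → ContinuousOn F1 (Ico 0 T) → F1 0 = Ψ1₀ + h 0 * Ψ 0 →
    (∀ t ∈ Ico 0 T, HasDerivWithinAt (fun s => Ψ s * Real.exp (∫ τ in (0:ℝ)..s, h τ)) (F1 t) (Ici t) t ∧
      HasDerivWithinAt F1 (F2 t) (Ici t) t ∧ F2 t - 2 * h t * F1 t ≤ 0) →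
    ∀ t ∈ Ico 0 T,
      Ψ t ≤ (Ψ 0 + (h 0 * Ψ 0 + Ψ1₀) * ∫ τ in (0:ℝ)..t, Real.exp (2 * ∫ s in (0:ℝ)..τ, h s)) *
          Real.exp (-∫ τ in (0:ℝ)..t, h τ) ∧
      0 ≤ ∫ τ in (0:ℝ)..t, h τ ∧ t ≤ ∫ τ in (0:ℝ)..t, Real.exp (2 * ∫ s in (0:ℝ)..τ, h s)

/-- **Step 11 (equivalence), p. 8**: "We also note that the conditions (1.5)-(1.6) are equivalent to
`σ₀ − νδ₀² − h₀ > 0`", `h₀ = √(g(0)₊)`, `a = σ₀ − νδ₀²`, `g = g(0)`. Arithmetic; true.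
[claim: Chae2005FiniteTimeSingularitiesWithdrawn, status: disputed] -/
def Step_11_equiv : Prop :=
  ∀ a g : ℝ, (0 < a ∧ g < a ^ 2) ↔ 0 < a - Real.sqrt (max g 0)

/-- **Step 11 — (2.16)–(2.17), pp. 7–8** [TeX 2.15–2.16]: "Going back to `‖ω(t)‖ = 1/Ψ(t)`, we have (2.16)
`‖ω(t)‖ ≥ ‖ω₀‖exp(∫₀ᵗh)/(1 − (‖ω₀‖′/‖ω₀‖ − h₀)∫₀ᵗexp(2∫₀^τh)dτ) = ‖ω₀‖exp(∫h)/(1 − [σ₀ − νδ₀² − h₀]∫₀ᵗexp(2∫h)dτ)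
≥ ‖ω₀‖/(1 − [σ₀ − νδ₀² − h₀]t)`, where we used the fact (2.17) `‖ω₀‖′ = (σ₀ − νδ₀²)‖ω₀‖`", valid while
`1 − [σ₀ − νδ₀² − h₀]t > 0`. Arithmetic grain (`y0 = ‖ω₀‖`, `yt = ‖ω(t)‖`, `Ψ₀′ = −‖ω₀‖′/‖ω₀‖² = −(a·y0)/y0²`,
`I = ∫₀ᵗe^{2∫h} ≥ t`, `Ht = ∫₀ᵗh ≥ 0`); true. [claim: Chae2005FiniteTimeSingularitiesWithdrawn, status: disputed] -/
def Step_11 : Prop :=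
  ∀ (y0 yt a g I Ht t : ℝ), 0 < y0 → 0 < yt → 0 ≤ t → t ≤ I → 0 ≤ Ht →
    0 < a - Real.sqrt (max g 0) → (a - Real.sqrt (max g 0)) * t < 1 →
    yt⁻¹ ≤ (y0⁻¹ + (Real.sqrt (max g 0) * y0⁻¹ + -(a * y0) / y0 ^ 2) * I) * Real.exp (-Ht) →
    y0 / (1 - (a - Real.sqrt (max g 0)) * t) ≤ yt

/-- **Step 12 — the conclusion, p. 8**: "We have from (2.16) `‖ω(t)‖_{L²} ↗ ∞` as `t ↗ T* = T*(v₀,ν,f₀) :=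
1/(σ₀ − νδ₀² − h₀)`, if the classical solution survives until `T*`, and we have proved (1.7)." TYPED as the closing
inference from the lower bound `‖ω(t)‖ ≥ ‖ω₀‖/(1 − κt)` (on a solution interval) to (1.8) and (1.7): the solution does not
survive past `1/κ`, and the maximal solution's `‖ω(t)‖_{L²}` is unbounded. The case of a lifespan `< 1/κ` is not treated in
the print; there the unboundedness is the continuation criterion "enstrophy bounded ⇒ the solution extends" — a tree theorem
for `ν > 0` (`hasSobolevExtensionPast_of_uniform_H1_bound` with the energy inequality), not known for `ν = 0` (IMPLICIT
step; lit-2 LOCATORS L4). [claim: Chae2005FiniteTimeSingularitiesWithdrawn, status: disputed] -/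
def Step_12 : Prop :=
  ∀ ν : ℝ, 0 ≤ ν → ∀ v₀ : EuclideanSpace ℝ (Fin 3) → EuclideanSpace ℝ (Fin 3), IsDatum v₀ → l2 (curl v₀) ≠ 0 →
    ∀ κ : ℝ, 0 < κ → ∀ T : ℝ, 0 < T →
      ∀ (u : ℝ → EuclideanSpace ℝ (Fin 3) → EuclideanSpace ℝ (Fin 3)) (p : ℝ → EuclideanSpace ℝ (Fin 3) → ℝ),
        IsLocalSolution ν T v₀ u p → (∀ t ∈ Ico 0 T, κ * t < 1 → wNorm u 0 / (1 - κ * t) ≤ wNorm u t) →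
          T ≤ 1 / κ ∧ (IsMaximal ν T v₀ u p → ∀ M : ℝ, ∃ t ∈ Ico 0 T, M < wNorm u t)

/-! ### Kernel relations -/

/-- A global solution in the class restricts to a local solution on every `[0,T)` (bookkeeping: restriction of the time set,
Mathlib `uniqueDiffOn_Ico`). [cite: Chae2005FiniteTimeSingularitiesWithdrawn, §1 p.2] -/
theorem isLocalSolution_of_global {ν : ℝ} {v₀ : EuclideanSpace ℝ (Fin 3) → EuclideanSpace ℝ (Fin 3)}
    {u : ℝ → EuclideanSpace ℝ (Fin 3) → EuclideanSpace ℝ (Fin 3)} {p : ℝ → EuclideanSpace ℝ (Fin 3) → ℝ}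
    (h : IsGlobalSolution ν v₀ u p) (T : ℝ) : IsLocalSolution ν T v₀ u p where
  isClassical := h.isClassical.mono Ico_subset_Ici_self (uniqueDiffOn_Ico 0 T)
  initial := h.initial
  sobolev := fun T'' _ => h.sobolev T''

/-- **The a priori chain pp. 5–8 on one solution interval** — Steps 2–11 give the printed lower bound
`‖ω(t)‖ ≥ ‖ω₀‖/(1 − κt)`, `κ = σ₀ − νδ₀² − h₀ > 0`, for every classical solution on `[0,T)` in the class from a datum with
`ω₀ ≢ 0` whose initial quotients satisfy (1.5)–(1.6), for `t ∈ [0,T)` with `κt < 1`. Pure logic (each abstract step is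
instantiated at the solution's quantities). [claim: Chae2005FiniteTimeSingularitiesWithdrawn, status: disputed] -/
theorem lowerBound_of_steps (h2 : Step_2) (h3 : Step_3) (h4 : Step_4) (h5 : Step_5) (h6 : Step_6) (h7 : Step_7)
    (h8 : Step_8) (h9 : Step_9) (h10 : Step_10) (h11e : Step_11_equiv) (h11 : Step_11)
    {ν : ℝ} (hν : 0 ≤ ν) {T : ℝ} (hT : 0 < T) {v₀ : EuclideanSpace ℝ (Fin 3) → EuclideanSpace ℝ (Fin 3)}
    {u : ℝ → EuclideanSpace ℝ (Fin 3) → EuclideanSpace ℝ (Fin 3)} {p : ℝ → EuclideanSpace ℝ (Fin 3) → ℝ}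
    (hsol : IsLocalSolution ν T v₀ u p) (hω : l2 (curl v₀) ≠ 0) (h15 : Cond15 ν u) (h16 : Cond16 ν u p) :
    ∀ t ∈ Ico 0 T, kappa ν u p * t < 1 → wNorm u 0 / (1 - kappa ν u p * t) ≤ wNorm u t := by
  intro t ht hκt
  -- standing positivity (p. 3) and (2.8)–(2.9) with the tacit regularity (p. 5)
  have hpos : ∀ s ∈ Ico 0 T, 0 < wNorm u s := h2 ν hν T hT v₀ u p hsol hω
  obtain ⟨hycont, hgcont, hCS, hder⟩ := h3 ν hν T hT v₀ u p hsol hpos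
  -- (2.10) as printed, then (2.11) up to its penultimate line
  have h210 := h4 ν hν T hT v₀ u p hsol
  obtain ⟨y2, hy2⟩ := h5 ν hν T hT v₀ u p hsol hpos h210 hder
  -- the two abstract inferences of p. 6, at each time
  have hG : ∀ s ∈ Ico 0 T,
      (3 * sigmaQ u s ^ 2 - gFun ν u p s) * wNorm u s ^ 2 ≤
        y2 s * wNorm u s + ((sigmaQ u s - ν * deltaQ u s ^ 2) * wNorm u s) ^ 2 ∧
      ((sigmaQ u s - ν * deltaQ u s ^ 2) * wNorm u s) ^ 2 ≤ sigmaQ u s ^ 2 * wNorm u s ^ 2 := by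
    intro s hs
    have hw := hpos s hs
    have hB : 0 ≤ sωNorm u s := Real.sqrt_nonneg _
    have hC : 0 ≤ lapVortNorm u s := Real.sqrt_nonneg _
    have hD : 0 ≤ gradVortNorm u s := Real.sqrt_nonneg _
    have h6' := h6 ν (wNorm u s) (sωNorm u s) (lapVortNorm u s) (gradVortNorm u s) (rhoQ u p s) (alphaQ u s)
      (sigmaQ u s) hν hw hB hC hD (hCS s hs)
    have h7' := h7 (sigmaQ u s) ν (deltaQ u s ^ 2) (wNorm u s) hν (sq_nonneg _) hw
    refine ⟨?_, h7'⟩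
    have hcoef : (3 * sigmaQ u s ^ 2 - gFun ν u p s) =
        (sigmaQ u s ^ 2 - rhoQ u p s + 2 * ν * alphaQ u s
          - 6 * ν * (sωNorm u s / wNorm u s) * (gradVortNorm u s / wNorm u s)
          + 2 * ν ^ 2 * (gradVortNorm u s / wNorm u s) ^ 2) := by
      unfold gFun betaQ deltaQ; ring
    rw [hcoef]
    exact h6'.trans (hy2 s hs).2
  -- Proposition 2.1 and (2.13) (p. 6–7)
  obtain ⟨Ψ1, Ψ2, hΨ⟩ := h8 T (wNorm u) (fun s => (sigmaQ u s - ν * deltaQ u s ^ 2) * wNorm u s) y2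
    (fun s => 3 * sigmaQ u s ^ 2 - gFun ν u p s) (sigmaQ u) hT
    (fun s hs => ⟨hpos s hs, hder s hs, (hy2 s hs).1, (hG s hs).1, (hG s hs).2⟩)
  -- the exponential multiplier (p. 7), h = √(g₊)
  set hf : ℝ → ℝ := fun s => Real.sqrt (max (gFun ν u p s) 0) with hhf
  have hhcont : ContinuousOn hf (Ico 0 T) :=
    (Real.continuous_sqrt.comp (continuous_id.max continuous_const)).comp_continuousOn hgcont
  have hh0 : ∀ s ∈ Ico 0 T, 0 ≤ hf s := fun s _ => Real.sqrt_nonneg _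
  have hsimp : ∀ s ∈ Ico 0 T, 3 * sigmaQ u s ^ 2 - (3 * sigmaQ u s ^ 2 - gFun ν u p s) = gFun ν u p s :=
    fun s _ => by ring
  obtain ⟨F1, F2, hF10, hF1cont, hF⟩ := h9 T (fun s => (wNorm u s)⁻¹) Ψ1 Ψ2 hf hT hhcont hh0
    (fun s hs => ⟨inv_pos.2 (hpos s hs), (hΨ s hs).1, (hΨ s hs).2.1, by
      have := (hΨ s hs).2.2.2.2; rw [hsimp s hs] at this; exact this⟩)
  -- (2.14)–(2.15) and the obvious estimates
  have hΨcont : ContinuousOn (fun s => (wNorm u s)⁻¹) (Ico 0 T) :=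
    hycont.inv₀ fun s hs => (hpos s hs).ne'
  obtain ⟨h215, hH0, hIt⟩ := h10 T (fun s => (wNorm u s)⁻¹) F1 F2 hf (Ψ1 0) hT hhcont hh0 hΨcont hF1cont hF10
    hF t ht
  -- (2.16)–(2.17): κ > 0 from (1.5)–(1.6), `Ψ₀′ = −(σ₀ − νδ₀²)/‖ω₀‖`
  have hκ : 0 < kappa ν u p := (h11e (sigmaQ u 0 - ν * deltaQ u 0 ^ 2) (gFun ν u p 0)).1 ⟨h15, h16⟩
  have h0T : (0 : ℝ) ∈ Ico 0 T := ⟨le_rfl, hT⟩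
  have hΨ10 : Ψ1 0 = -((sigmaQ u 0 - ν * deltaQ u 0 ^ 2) * wNorm u 0) / wNorm u 0 ^ 2 := (hΨ 0 h0T).2.2.1
  rw [hΨ10] at h215
  exact h11 (wNorm u 0) (wNorm u t) (sigmaQ u 0 - ν * deltaQ u 0 ^ 2) (gFun ν u p 0) _ _ t (hpos 0 h0T) (hpos t ht)
    ht.1 hIt hH0 hκ hκt h215

/-- **Composition — Steps 2–12 in the printed order give Theorem 1.1 (1.7)–(1.8).** For a GLOBAL solution in the class
with (1.5)–(1.6): restrict to `[0, 1/κ + 1)` (`isLocalSolution_of_global`), run the chain (`lowerBound_of_steps`), and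
`Step_12` bounds the length by `1/κ` — contradiction (blow-up in finite time). For the MAXIMAL solution on `[0,T)`: the
chain and `Step_12` give `T ≤ 1/κ` (1.8) and the unboundedness of `‖ω(t)‖_{L²}` (1.7). `Step_1` (the setting) is on the
printed path but is not consumed once `Step_12` is granted. Pure logic; nothing is asserted.
[claim: Chae2005FiniteTimeSingularitiesWithdrawn, status: disputed] -/
theorem claim_of_steps (_h1 : Step_1) (h2 : Step_2) (h3 : Step_3) (h4 : Step_4) (h5 : Step_5) (h6 : Step_6)
    (h7 : Step_7) (h8 : Step_8) (h9 : Step_9) (h10 : Step_10) (h11e : Step_11_equiv) (h11 : Step_11)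
    (h12 : Step_12) : ClaimedTheorem := by
  intro ν hν v₀ hv₀ hω
  refine ⟨fun u p hglob h15 h16 => ?_, fun T hT u p hsol hmax h15 h16 => ?_⟩
  · -- no global solution: restrict to `[0, 1/κ + 1)`
    have hκ : 0 < kappa ν u p := (h11e (sigmaQ u 0 - ν * deltaQ u 0 ^ 2) (gFun ν u p 0)).1 ⟨h15, h16⟩
    have hT : (0 : ℝ) < 1 / kappa ν u p + 1 := by positivity
    have hloc : IsLocalSolution ν (1 / kappa ν u p + 1) v₀ u p := isLocalSolution_of_global hglob _
    have hlb := lowerBound_of_steps h2 h3 h4 h5 h6 h7 h8 h9 h10 h11e h11 hν hT hloc hω h15 h16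
    have hle := (h12 ν hν v₀ hv₀ hω (kappa ν u p) hκ (1 / kappa ν u p + 1) hT u p hloc hlb).1
    linarith
  · -- the maximal solution: (1.8) and (1.7)
    have hκ : 0 < kappa ν u p := (h11e (sigmaQ u 0 - ν * deltaQ u 0 ^ 2) (gFun ν u p 0)).1 ⟨h15, h16⟩
    have hlb := lowerBound_of_steps h2 h3 h4 h5 h6 h7 h8 h9 h10 h11e h11 hν hT hsol hω h15 h16
    obtain ⟨hle, hunb⟩ := h12 ν hν v₀ hv₀ hω (kappa ν u p) hκ T hT u p hsol hlb
    exact ⟨hle, hunb hmax⟩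

/-! ### The Euler conjunct without (2.10) (rev 2, additive)

At `ν = 0` the print does not use (2.10): (2.11) then follows from (2.3), (2.5) alone
(`½ d²/dt²‖ω‖² = ‖Sω‖² − ∫P_ij ω_i ω_j`). `Step_5E` is `Step_5` at `ν = 0` WITHOUT the (2.10) hypothesis (the `ν`-terms
are displayed at `ν = 0` so that the statement is literally that instance), and `claim_of_steps_euler` composes the
Euler conjunct from Steps 2, 3, 5E, 6–12 — so the Euler part's dependency set does not contain `Step_4`. -/

/-- **Step 5E — (2.11) at `ν = 0`, pp. 5–6, from (2.3) and (2.5) only** («`½ d²/dt² ∫|ω|² = ‖Sω‖² − Σ∫P_ij ω_i ω_j`» —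
the `ν`-terms of (2.11) vanish and (2.10) is not invoked): typed as `Step_5` at `ν = 0` without the (2.10) hypothesis.
True (calculus along a classical Euler solution in the class with `‖ω(t)‖ ≠ 0`).
[claim: Chae2005FiniteTimeSingularitiesWithdrawn, status: disputed] -/
def Step_5E : Prop :=
  ∀ T : ℝ, 0 < T → ∀ (v₀ : EuclideanSpace ℝ (Fin 3) → EuclideanSpace ℝ (Fin 3))
    (u : ℝ → EuclideanSpace ℝ (Fin 3) → EuclideanSpace ℝ (Fin 3)) (p : ℝ → EuclideanSpace ℝ (Fin 3) → ℝ),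
    IsLocalSolution 0 T v₀ u p → (∀ t ∈ Ico 0 T, 0 < wNorm u t) →
    (∀ t ∈ Ico 0 T, HasDerivWithinAt (wNorm u) ((sigmaQ u t - 0 * deltaQ u t ^ 2) * wNorm u t) (Ici t) t) →
      ∃ y2 : ℝ → ℝ, ∀ t ∈ Ico 0 T,
        HasDerivWithinAt (fun s => (sigmaQ u s - 0 * deltaQ u s ^ 2) * wNorm u s) (y2 t) (Ici t) t ∧
        sωNorm u t ^ 2 + (-rhoQ u p t + 2 * 0 * alphaQ u t) * wNorm u t ^ 2
            - 6 * 0 * sωNorm u t * lapVortNorm u t + 2 * 0 ^ 2 * lapVortNorm u t ^ 2 ≤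
          y2 t * wNorm u t + ((sigmaQ u t - 0 * deltaQ u t ^ 2) * wNorm u t) ^ 2

/-- `Step_5E` is what `Step_4` and `Step_5` give at `ν = 0` (so the Euler route assumes less). Pure logic.
[cite: Chae2005FiniteTimeSingularitiesWithdrawn, §2 (2.11) pp.5–6] -/
theorem step5E_of_step4_step5 (h4 : Step_4) (h5 : Step_5) : Step_5E :=
  fun T hT v₀ u p hsol hpos hder =>
    h5 0 le_rfl T hT v₀ u p hsol hpos (h4 0 le_rfl T hT v₀ u p hsol) hder

/-- **The a priori chain at `ν = 0` without (2.10)**: Steps 2, 3, 5E, 6–11 give the printed lower bound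
`‖ω(t)‖ ≥ ‖ω₀‖/(1 − κt)` for every classical Euler solution on `[0,T)` in the class whose initial quotients satisfy
(1.5)–(1.6). Pure logic (same script as `lowerBound_of_steps`). [claim: Chae2005FiniteTimeSingularitiesWithdrawn, status: disputed] -/
theorem lowerBound_of_steps_euler (h2 : Step_2) (h3 : Step_3) (h5E : Step_5E) (h6 : Step_6) (h7 : Step_7)
    (h8 : Step_8) (h9 : Step_9) (h10 : Step_10) (h11e : Step_11_equiv) (h11 : Step_11)
    {T : ℝ} (hT : 0 < T) {v₀ : EuclideanSpace ℝ (Fin 3) → EuclideanSpace ℝ (Fin 3)}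
    {u : ℝ → EuclideanSpace ℝ (Fin 3) → EuclideanSpace ℝ (Fin 3)} {p : ℝ → EuclideanSpace ℝ (Fin 3) → ℝ}
    (hsol : IsLocalSolution 0 T v₀ u p) (hω : l2 (curl v₀) ≠ 0) (h15 : Cond15 0 u) (h16 : Cond16 0 u p) :
    ∀ t ∈ Ico 0 T, kappa 0 u p * t < 1 → wNorm u 0 / (1 - kappa 0 u p * t) ≤ wNorm u t := by
  intro t ht hκt
  have hν : (0 : ℝ) ≤ 0 := le_rfl
  have hpos : ∀ s ∈ Ico 0 T, 0 < wNorm u s := h2 0 hν T hT v₀ u p hsol hω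
  obtain ⟨hycont, hgcont, hCS, hder⟩ := h3 0 hν T hT v₀ u p hsol hpos
  obtain ⟨y2, hy2⟩ := h5E T hT v₀ u p hsol hpos hder
  have hG : ∀ s ∈ Ico 0 T,
      (3 * sigmaQ u s ^ 2 - gFun 0 u p s) * wNorm u s ^ 2 ≤
        y2 s * wNorm u s + ((sigmaQ u s - 0 * deltaQ u s ^ 2) * wNorm u s) ^ 2 ∧
      ((sigmaQ u s - 0 * deltaQ u s ^ 2) * wNorm u s) ^ 2 ≤ sigmaQ u s ^ 2 * wNorm u s ^ 2 := by
    intro s hs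
    have hw := hpos s hs
    have hB : 0 ≤ sωNorm u s := Real.sqrt_nonneg _
    have hC : 0 ≤ lapVortNorm u s := Real.sqrt_nonneg _
    have hD : 0 ≤ gradVortNorm u s := Real.sqrt_nonneg _
    have h6' := h6 0 (wNorm u s) (sωNorm u s) (lapVortNorm u s) (gradVortNorm u s) (rhoQ u p s) (alphaQ u s)
      (sigmaQ u s) hν hw hB hC hD (hCS s hs)
    have h7' := h7 (sigmaQ u s) 0 (deltaQ u s ^ 2) (wNorm u s) hν (sq_nonneg _) hw
    refine ⟨?_, h7'⟩
    have hcoef : (3 * sigmaQ u s ^ 2 - gFun 0 u p s) =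
        (sigmaQ u s ^ 2 - rhoQ u p s + 2 * 0 * alphaQ u s
          - 6 * 0 * (sωNorm u s / wNorm u s) * (gradVortNorm u s / wNorm u s)
          + 2 * 0 ^ 2 * (gradVortNorm u s / wNorm u s) ^ 2) := by
      unfold gFun betaQ deltaQ; ring
    rw [hcoef]
    exact h6'.trans (hy2 s hs).2
  obtain ⟨Ψ1, Ψ2, hΨ⟩ := h8 T (wNorm u) (fun s => (sigmaQ u s - 0 * deltaQ u s ^ 2) * wNorm u s) y2
    (fun s => 3 * sigmaQ u s ^ 2 - gFun 0 u p s) (sigmaQ u) hT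
    (fun s hs => ⟨hpos s hs, hder s hs, (hy2 s hs).1, (hG s hs).1, (hG s hs).2⟩)
  set hf : ℝ → ℝ := fun s => Real.sqrt (max (gFun 0 u p s) 0) with hhf
  have hhcont : ContinuousOn hf (Ico 0 T) :=
    (Real.continuous_sqrt.comp (continuous_id.max continuous_const)).comp_continuousOn hgcont
  have hh0 : ∀ s ∈ Ico 0 T, 0 ≤ hf s := fun s _ => Real.sqrt_nonneg _
  have hsimp : ∀ s ∈ Ico 0 T, 3 * sigmaQ u s ^ 2 - (3 * sigmaQ u s ^ 2 - gFun 0 u p s) = gFun 0 u p s :=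
    fun s _ => by ring
  obtain ⟨F1, F2, hF10, hF1cont, hF⟩ := h9 T (fun s => (wNorm u s)⁻¹) Ψ1 Ψ2 hf hT hhcont hh0
    (fun s hs => ⟨inv_pos.2 (hpos s hs), (hΨ s hs).1, (hΨ s hs).2.1, by
      have := (hΨ s hs).2.2.2.2; rw [hsimp s hs] at this; exact this⟩)
  have hΨcont : ContinuousOn (fun s => (wNorm u s)⁻¹) (Ico 0 T) :=
    hycont.inv₀ fun s hs => (hpos s hs).ne'
  obtain ⟨h215, hH0, hIt⟩ := h10 T (fun s => (wNorm u s)⁻¹) F1 F2 hf (Ψ1 0) hT hhcont hh0 hΨcont hF1cont hF10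
    hF t ht
  have hκ : 0 < kappa 0 u p := (h11e (sigmaQ u 0 - 0 * deltaQ u 0 ^ 2) (gFun 0 u p 0)).1 ⟨h15, h16⟩
  have h0T : (0 : ℝ) ∈ Ico 0 T := ⟨le_rfl, hT⟩
  have hΨ10 : Ψ1 0 = -((sigmaQ u 0 - 0 * deltaQ u 0 ^ 2) * wNorm u 0) / wNorm u 0 ^ 2 := (hΨ 0 h0T).2.2.1
  rw [hΨ10] at h215
  exact h11 (wNorm u 0) (wNorm u t) (sigmaQ u 0 - 0 * deltaQ u 0 ^ 2) (gFun 0 u p 0) _ _ t (hpos 0 h0T) (hpos t ht)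
    ht.1 hIt hH0 hκ hκt h215

/-- **Composition of the EULER conjunct without `Step_4`**: Steps 2, 3, 5E, 6–12 give `ClaimedTheoremEuler`
(Remark 1.1: «including the Euler equations»). Pure logic; nothing is asserted.
[claim: Chae2005FiniteTimeSingularitiesWithdrawn, status: disputed] -/
theorem claim_of_steps_euler (h2 : Step_2) (h3 : Step_3) (h5E : Step_5E) (h6 : Step_6) (h7 : Step_7)
    (h8 : Step_8) (h9 : Step_9) (h10 : Step_10) (h11e : Step_11_equiv) (h11 : Step_11) (h12 : Step_12) :
    ClaimedTheoremEuler := by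
  intro v₀ hv₀ hω
  refine ⟨fun u p hglob h15 h16 => ?_, fun T hT u p hsol hmax h15 h16 => ?_⟩
  · have hκ : 0 < kappa 0 u p := (h11e (sigmaQ u 0 - 0 * deltaQ u 0 ^ 2) (gFun 0 u p 0)).1 ⟨h15, h16⟩
    have hT : (0 : ℝ) < 1 / kappa 0 u p + 1 := by positivity
    have hloc : IsLocalSolution 0 (1 / kappa 0 u p + 1) v₀ u p := isLocalSolution_of_global hglob _
    have hlb := lowerBound_of_steps_euler h2 h3 h5E h6 h7 h8 h9 h10 h11e h11 hT hloc hω h15 h16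
    have hle := (h12 0 le_rfl v₀ hv₀ hω (kappa 0 u p) hκ (1 / kappa 0 u p + 1) hT u p hloc hlb).1
    linarith
  · have hκ : 0 < kappa 0 u p := (h11e (sigmaQ u 0 - 0 * deltaQ u 0 ^ 2) (gFun 0 u p 0)).1 ⟨h15, h16⟩
    have hlb := lowerBound_of_steps_euler h2 h3 h5E h6 h7 h8 h9 h10 h11e h11 hT hsol hω h15 h16
    obtain ⟨hle, hunb⟩ := h12 0 le_rfl v₀ hv₀ hω (kappa 0 u p) hκ T hT u p hsol hlb
    exact ⟨hle, hunb hmax⟩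


/-! ## D-0026 in-file discharges of the TRUE abstract-grain steps (8, 10, 11-equiv, 11)

Ports, verbatim up to namespacing, of ns-claims-salvage-p4 g2's kernel proofs in
`Summits/NavierStokesRegularity/NavierStokesRegularity/Theorems/SoloSalvageChae2005.lean` (parts 1–2, p480998),
which a Literature file cannot import (D-0017: Literature never imports Summits). Nothing disputed is asserted:
`Step_6`, `Step_7`, `Step_9` (FALSE, refuted summit-side by `…Theorems.Chae2005.not_Step_6/7/9`) are untouched, as are
the solution-grain Steps 1–5, 12 and every statement above. (ns-claims-typist-11 g4, D-0026 debt pass, own lineage.) -/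

/-- **Step 11 (equivalence), p. 8, is TRUE**: «(1.5)-(1.6) are equivalent to `σ₀ − νδ₀² − h₀ > 0`», `h₀ = √(g(0)₊)`:
`(0 < a ∧ g < a²) ↔ 0 < a − √(max g 0)`. Arithmetic (`Real.sqrt_lt'`, `Real.lt_sqrt`).
[cite: Chae2005FiniteTimeSingularitiesWithdrawn, (2.16)–(2.17) p. 8] -/
theorem step11_equiv_holds : Step_11_equiv := by
  intro a g
  constructor
  · rintro ⟨ha, hg⟩
    have : Real.sqrt (max g 0) < a := by
      rw [Real.sqrt_lt' ha]
      exact max_lt hg (by positivity)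
    linarith
  · intro h
    have hs : Real.sqrt (max g 0) < a := by linarith
    have h0 : 0 ≤ Real.sqrt (max g 0) := Real.sqrt_nonneg _
    have ha : 0 < a := lt_of_le_of_lt h0 hs
    refine ⟨ha, ?_⟩
    have := (Real.sqrt_lt' ha).1 hs
    exact lt_of_le_of_lt (le_max_left g 0) this

/-- **Step 11, (2.16)–(2.17) pp. 7–8, is TRUE** at the typed arithmetic grain: with `y0 = ‖ω₀‖ > 0`, `yt = ‖ω(t)‖ > 0`,
`κ = a − √(g₊) > 0`, `κt < 1`, `t ≤ I`, `Ht ≥ 0` and (2.15) in the form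
`yt⁻¹ ≤ (y0⁻¹ + (√(g₊)·y0⁻¹ − a·y0/y0²)·I)·e^{−Ht}`, one gets `y0/(1 − κt) ≤ yt`. (The coefficient is `−κ/y0`; if
`1 − κI ≤ 0` the hypothesis contradicts `yt > 0`, else `yt⁻¹ ≤ (1 − κI)/y0 ≤ (1 − κt)/y0`.)
[cite: Chae2005FiniteTimeSingularitiesWithdrawn, (2.16)–(2.17) pp. 7–8] -/
theorem step11_holds : Step_11 := by
  intro y0 yt a g I Ht t hy0 hyt ht htI hHt hκ hκt h215
  set κ : ℝ := a - Real.sqrt (max g 0) with hκdef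
  -- rewrite the coefficient of `I`
  have hcoef : Real.sqrt (max g 0) * y0⁻¹ + -(a * y0) / y0 ^ 2 = -κ / y0 := by
    rw [hκdef]
    field_simp
    ring
  rw [hcoef] at h215
  have hexp : Real.exp (-Ht) ≤ 1 := by
    rw [Real.exp_le_one_iff]; linarith
  have hexp0 : 0 < Real.exp (-Ht) := Real.exp_pos _
  have h1κt : 0 < 1 - κ * t := by linarith
  -- the bracket `(y0⁻¹ + (-κ / y0) * I) = (1 - κ I)/y0`
  have hbr : y0⁻¹ + -κ / y0 * I = (1 - κ * I) / y0 := by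
    field_simp
    ring
  rw [hbr] at h215
  by_cases hI : 1 - κ * I ≤ 0
  · -- contradiction with yt > 0
    exfalso
    have hnonpos : (1 - κ * I) / y0 * Real.exp (-Ht) ≤ 0 :=
      mul_nonpos_of_nonpos_of_nonneg (div_nonpos_of_nonpos_of_nonneg hI hy0.le) hexp0.le
    have : (0 : ℝ) < yt⁻¹ := inv_pos.mpr hyt
    linarith
  · push Not at hI
    have hA : (1 - κ * I) / y0 * Real.exp (-Ht) ≤ (1 - κ * I) / y0 := by
      have hnn : 0 ≤ (1 - κ * I) / y0 := div_nonneg hI.le hy0.le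
      calc (1 - κ * I) / y0 * Real.exp (-Ht) ≤ (1 - κ * I) / y0 * 1 :=
            mul_le_mul_of_nonneg_left hexp hnn
        _ = (1 - κ * I) / y0 := mul_one _
    have hB : (1 - κ * I) / y0 ≤ (1 - κ * t) / y0 := by
      apply div_le_div_of_nonneg_right _ hy0.le
      have : κ * t ≤ κ * I := mul_le_mul_of_nonneg_left htI hκ.le
      linarith
    have hC : yt⁻¹ ≤ (1 - κ * t) / y0 := h215.trans (hA.trans hB)
    -- invert
    have hpos : 0 < (1 - κ * t) / y0 := div_pos h1κt hy0
    have := inv_anti₀ (inv_pos.mpr hyt) hC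
    -- `this : ((1 - κ t)/y0)⁻¹ ≤ (yt⁻¹)⁻¹`
    rwa [inv_inv, inv_div] at this

/-- **Step 8, pp. 6–7 ((2.12) ⇒ Prop 2.1 (2.6)–(2.7) ⇒ (2.13)), is TRUE** at the typed abstract grain: for `y > 0` with right
derivatives `y′ = y1`, `y1′ = y2` on `[0,T)`, `G y² ≤ y2·y + y1²` and `y1² ≤ σ² y²`, the function `Ψ = 1/y` has right
derivatives `Ψ1 = −y1/y²`, `Ψ2 = −y2/y² + 2y1²/y³` with `Ψ2 ≤ (3σ² − G)Ψ` and `Ψ2 − (√((3σ² − G)₊))²Ψ ≤ 0`.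
Calculus (`HasDerivWithinAt.inv`, `.div`, `.pow`) + arithmetic. [cite: Chae2005FiniteTimeSingularitiesWithdrawn, (2.12)–(2.13) pp. 6–7] -/
theorem step8_holds : Step_8 := by
  intro T y y1 y2 G σf hT hyp
  refine ⟨fun t => -y1 t / y t ^ 2, fun t => -y2 t / y t ^ 2 + 2 * y1 t ^ 2 / y t ^ 3, ?_⟩
  intro t ht
  obtain ⟨hy, hdy, hdy1, hG, hσ⟩ := hyp t ht
  have hy0 : y t ≠ 0 := hy.ne'
  have hy2 : y t ^ 2 ≠ 0 := pow_ne_zero 2 hy0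
  have hy3 : 0 < y t ^ 3 := pow_pos hy 3
  -- the key inequality `Ψ2 ≤ (3σ² − G)/y`
  have hΨ2 : -y2 t / y t ^ 2 + 2 * y1 t ^ 2 / y t ^ 3 ≤ (3 * σf t ^ 2 - G t) * (y t)⁻¹ := by
    have e1 : -y2 t / y t ^ 2 + 2 * y1 t ^ 2 / y t ^ 3 = (-y2 t * y t + 2 * y1 t ^ 2) / y t ^ 3 := by
      field_simp
    have e2 : (3 * σf t ^ 2 - G t) * (y t)⁻¹ = ((3 * σf t ^ 2 - G t) * y t ^ 2) / y t ^ 3 := by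
      field_simp
    rw [e1, e2]
    exact div_le_div_of_nonneg_right (by nlinarith [hG, hσ]) hy3.le
  refine ⟨?_, ?_, rfl, hΨ2, ?_⟩
  · -- derivative of 1/y
    exact hdy.inv hy0
  · -- derivative of Ψ1 = -y1 / y^2
    have hnum : HasDerivWithinAt (fun s => -y1 s) (-y2 t) (Ici t) t := hdy1.neg
    have hden : HasDerivWithinAt (fun s => y s ^ 2) (↑(2:ℕ) * y t ^ (2 - 1) * y1 t) (Ici t) t := hdy.pow 2
    have hq := hnum.div hden hy2
    have heq : (-y2 t * y t ^ 2 - -y1 t * (↑(2:ℕ) * y t ^ (2 - 1) * y1 t)) / (y t ^ 2) ^ 2 =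
        -y2 t / y t ^ 2 + 2 * y1 t ^ 2 / y t ^ 3 := by
      push_cast
      field_simp
      ring
    rw [heq] at hq
    exact hq
  · -- Ψ2 − (√(X₊))² Ψ ≤ 0
    have hX : Real.sqrt (max (3 * σf t ^ 2 - G t) 0) ^ 2 = max (3 * σf t ^ 2 - G t) 0 :=
      Real.sq_sqrt (le_max_right _ _)
    have hmax : (3 * σf t ^ 2 - G t) * (y t)⁻¹ ≤ max (3 * σf t ^ 2 - G t) 0 * (y t)⁻¹ :=
      mul_le_mul_of_nonneg_right (le_max_left _ _) (inv_pos.mpr hy).le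
    show -y2 t / y t ^ 2 + 2 * y1 t ^ 2 / y t ^ 3 - Real.sqrt (max (3 * σf t ^ 2 - G t) 0) ^ 2 * (y t)⁻¹ ≤ 0
    rw [hX]
    linarith

/-! ### Step 10 ((2.14) ⇒ (2.15), p. 7–8) -/

/-- FTC from the right on `[0,T)`: for `g` continuous on `Ico 0 T`, the primitive `s ↦ ∫₀ˢ g` has right
derivative `g t` at every `t ∈ [0,T)` (Mathlib's `intervalIntegral.integral_hasDerivWithinAt_right` with the
`𝓝[≥] t` / `𝓝[>] t` filter pair). [folklore] -/
private theorem hasDerivWithinAt_primitive_Ici {g : ℝ → ℝ} {T : ℝ} (hg : ContinuousOn g (Ico 0 T))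
    {t : ℝ} (ht : t ∈ Ico 0 T) :
    HasDerivWithinAt (fun s => ∫ τ in (0:ℝ)..s, g τ) (g t) (Ici t) t := by
  have hsub : uIcc (0:ℝ) t ⊆ Ico 0 T := by
    rw [uIcc_of_le ht.1]; exact fun r hr => ⟨hr.1, hr.2.trans_lt ht.2⟩
  have hint : IntervalIntegrable g volume 0 t := (hg.mono hsub).intervalIntegrable
  have hmem : Ico 0 T ∈ 𝓝[>] t :=
    mem_of_superset (Ioo_mem_nhdsGT ht.2) fun r hr => ⟨ht.1.trans hr.1.le, hr.2⟩
  have hle : 𝓝[>] t ≤ 𝓝[Ico 0 T] t := nhdsWithin_le_iff.2 hmem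
  have hmeas : StronglyMeasurableAtFilter g (𝓝[>] t) volume :=
    (hg.stronglyMeasurableAtFilter_nhdsWithin measurableSet_Ico t).filter_mono hle
  have hcont : ContinuousWithinAt g (Ioi t) t := (hg t ht).mono_of_mem_nhdsWithin hmem
  exact intervalIntegral.integral_hasDerivWithinAt_right hint hmeas hcont

/-- The primitive of a function continuous on `Ico 0 T` is continuous on every `Icc 0 t`, `t < T`. [folklore] -/
private theorem continuousOn_primitive_Icc {g : ℝ → ℝ} {T : ℝ} (hg : ContinuousOn g (Ico 0 T))
    {t : ℝ} (ht : t ∈ Ico 0 T) :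
    ContinuousOn (fun s => ∫ τ in (0:ℝ)..s, g τ) (Icc 0 t) := by
  have hsub : Icc (0:ℝ) t ⊆ Ico 0 T := fun r hr => ⟨hr.1, hr.2.trans_lt ht.2⟩
  have hint : IntegrableOn g (uIcc 0 t) volume := by
    rw [uIcc_of_le ht.1]; exact (hg.mono hsub).integrableOn_Icc
  have h := intervalIntegral.continuousOn_primitive_interval hint
  rw [uIcc_of_le ht.1] at h
  exact h

/-- **Step 10, (2.14) ⇒ (2.15) and the «obvious estimates», p. 7–8, is TRUE** at the typed abstract grain: with
`H = ∫₀ᵗ h` (`h ≥ 0` continuous on `[0,T)`), `F = Ψe^{H}` having right derivative `F1` and `F1` right derivative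
`F2` with `F2 − 2hF1 ≤ 0`, one gets (2.15) `Ψ(t) ≤ [Ψ₀ + (h₀Ψ₀ + Ψ₀′)∫₀ᵗ e^{2H}] e^{−H(t)}`, `H(t) ≥ 0` and
`∫₀ᵗ e^{2H} ≥ t`. Proof: `F1·e^{−2H}` has right derivative `(F2 − 2hF1)e^{−2H} ≤ 0`, so `F1 ≤ F1(0)e^{2H}`
(one-sided fence); a second fence integrates `F′ = F1 ≤ F1(0)e^{2H}`. (The step is AFTER the locators
`Step_6`/`Step_9`; it is the honest integrating-factor calculus the print invokes.)
[cite: Chae2005FiniteTimeSingularitiesWithdrawn, (2.14)–(2.15) p. 7–8] -/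
theorem step10_holds : Step_10 := by
  intro T Ψ F1 F2 h Ψ1₀ hT hh hh0 hΨ hF1 hF10 hyp t ht
  -- the primitive `H = ∫₀ h` and its right derivative
  set H : ℝ → ℝ := fun s => ∫ τ in (0:ℝ)..s, h τ with hHdef
  have hHder : ∀ s ∈ Ico (0:ℝ) T, HasDerivWithinAt H (h s) (Ici s) s := fun s hs =>
    hasDerivWithinAt_primitive_Ici hh hs
  have hH0 : H 0 = 0 := by simp [hHdef]
  have hHnn : ∀ s ∈ Ico (0:ℝ) T, 0 ≤ H s := fun s hs =>
    intervalIntegral.integral_nonneg hs.1 fun u hu => hh0 u ⟨hu.1, hu.2.trans_lt hs.2⟩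
  -- an intermediate time `t < t₁ < T`, so that everything is continuous on `[0, t₁] ⊇ [0, t]`
  set t₁ : ℝ := (t + T) / 2 with ht₁def
  have ht₁ : t₁ ∈ Ico (0:ℝ) T := ⟨by rw [ht₁def]; linarith [ht.1, ht.2], by rw [ht₁def]; linarith [ht.2]⟩
  have htt₁ : t < t₁ := by rw [ht₁def]; linarith [ht.2]
  have hHcont₁ : ContinuousOn H (Icc 0 t₁) := continuousOn_primitive_Icc hh ht₁
  have hHcontIco : ContinuousOn H (Ico 0 t₁) := hHcont₁.mono Ico_subset_Icc_self
  -- Step A: `F1 s · e^{−2H(s)} ≤ F1 0` on `[0, t₁)`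
  have hA : ∀ s ∈ Ico (0:ℝ) t₁, F1 s * Real.exp (-2 * H s) ≤ F1 0 := by
    intro s hs
    have hsT : Icc (0:ℝ) s ⊆ Ico 0 T := fun r hr => ⟨hr.1, (hr.2.trans_lt hs.2).trans ht₁.2⟩
    have hGcont : ContinuousOn (fun r => F1 r * Real.exp (-2 * H r)) (Icc 0 s) :=
      (hF1.mono hsT).mul ((Real.continuous_exp.comp_continuousOn
        (((hHcont₁.mono (Icc_subset_Icc_right hs.2.le))).const_smul (-2 : ℝ))).congr fun r _ => by
          simp [smul_eq_mul])
    have hGder : ∀ r ∈ Ico (0:ℝ) s, HasDerivWithinAt (fun r => F1 r * Real.exp (-2 * H r))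
        (F2 r * Real.exp (-2 * H r) + F1 r * (Real.exp (-2 * H r) * (-2 * h r))) (Ici r) r := by
      intro r hr
      have hrT : r ∈ Ico (0:ℝ) T := ⟨hr.1, (hr.2.trans hs.2).trans ht₁.2⟩
      have h1 : HasDerivWithinAt (fun r => -2 * H r) (-2 * h r) (Ici r) r := (hHder r hrT).const_mul (-2)
      exact (hyp r hrT).2.1.mul h1.exp
    have hbound : ∀ r ∈ Ico (0:ℝ) s,
        F2 r * Real.exp (-2 * H r) + F1 r * (Real.exp (-2 * H r) * (-2 * h r)) ≤ 0 := by
      intro r hr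
      have hrT : r ∈ Ico (0:ℝ) T := ⟨hr.1, (hr.2.trans hs.2).trans ht₁.2⟩
      have hineq : F2 r - 2 * h r * F1 r ≤ 0 := (hyp r hrT).2.2
      have hpos : 0 < Real.exp (-2 * H r) := Real.exp_pos _
      have : F2 r * Real.exp (-2 * H r) + F1 r * (Real.exp (-2 * H r) * (-2 * h r)) =
          (F2 r - 2 * h r * F1 r) * Real.exp (-2 * H r) := by ring
      rw [this]
      exact mul_nonpos_of_nonpos_of_nonneg hineq hpos.le
    have h0 : F1 0 * Real.exp (-2 * H 0) ≤ F1 0 := by rw [hH0, mul_zero, Real.exp_zero, mul_one]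
    exact image_le_of_deriv_right_le_deriv_boundary (B := fun _ => F1 0) (B' := fun _ => 0) hGcont hGder h0
      continuousOn_const (fun r _ => hasDerivWithinAt_const r (Ici r) (F1 0)) hbound (right_mem_Icc.2 hs.1)
  -- consequence: `F1 s ≤ F1(0) e^{2H(s)}`
  have hA' : ∀ s ∈ Ico (0:ℝ) t₁, F1 s ≤ F1 0 * Real.exp (2 * H s) := by
    intro s hs
    have h := mul_le_mul_of_nonneg_right (hA s hs) (Real.exp_pos (2 * H s)).le
    have hexp : Real.exp (-2 * H s) * Real.exp (2 * H s) = 1 := by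
      rw [← Real.exp_add]; simp
    calc F1 s = F1 s * (Real.exp (-2 * H s) * Real.exp (2 * H s)) := by rw [hexp, mul_one]
      _ = F1 s * Real.exp (-2 * H s) * Real.exp (2 * H s) := by ring
      _ ≤ F1 0 * Real.exp (2 * H s) := h
  -- Step B: the second fence, for `F = Ψ e^{H}` against `Ψ 0 + F1(0) ∫₀ e^{2H}`
  set I : ℝ → ℝ := fun s => ∫ τ in (0:ℝ)..s, Real.exp (2 * H τ) with hIdef
  have hE2cont : ContinuousOn (fun τ => Real.exp (2 * H τ)) (Ico 0 t₁) :=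
    Real.continuous_exp.comp_continuousOn ((hHcontIco.const_smul (2 : ℝ)).congr fun r _ => by
      simp [smul_eq_mul])
  have hIder : ∀ r ∈ Ico (0:ℝ) t₁, HasDerivWithinAt I (Real.exp (2 * H r)) (Ici r) r := fun r hr =>
    hasDerivWithinAt_primitive_Ici hE2cont hr
  have hI0 : I 0 = 0 := by simp [hIdef]
  have htIco : t ∈ Ico (0:ℝ) t₁ := ⟨ht.1, htt₁⟩
  have hIcont : ContinuousOn I (Icc 0 t) := continuousOn_primitive_Icc hE2cont htIco
  have hsubt : Icc (0:ℝ) t ⊆ Ico 0 T := fun r hr => ⟨hr.1, hr.2.trans_lt ht.2⟩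
  have hFcont : ContinuousOn (fun r => Ψ r * Real.exp (H r)) (Icc 0 t) :=
    (hΨ.mono hsubt).mul (Real.continuous_exp.comp_continuousOn (hHcont₁.mono (Icc_subset_Icc_right htt₁.le)))
  have hFder : ∀ r ∈ Ico (0:ℝ) t, HasDerivWithinAt (fun s => Ψ s * Real.exp (H s)) (F1 r) (Ici r) r :=
    fun r hr => (hyp r ⟨hr.1, hr.2.trans ht.2⟩).1
  have hBcont : ContinuousOn (fun r => Ψ 0 + F1 0 * I r) (Icc 0 t) :=
    continuousOn_const.add (hIcont.const_smul (F1 0) |>.congr fun r _ => by simp [smul_eq_mul])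
  have hBder : ∀ r ∈ Ico (0:ℝ) t,
      HasDerivWithinAt (fun r => Ψ 0 + F1 0 * I r) (F1 0 * Real.exp (2 * H r)) (Ici r) r := by
    intro r hr
    have := ((hIder r ⟨hr.1, hr.2.trans htt₁⟩).const_mul (F1 0)).const_add (Ψ 0)
    simpa using this
  have ha : Ψ 0 * Real.exp (H 0) ≤ Ψ 0 + F1 0 * I 0 := by
    rw [hH0, hI0, Real.exp_zero, mul_one, mul_zero, add_zero]
  have hboundB : ∀ r ∈ Ico (0:ℝ) t, F1 r ≤ F1 0 * Real.exp (2 * H r) := fun r hr =>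
    hA' r ⟨hr.1, hr.2.trans htt₁⟩
  have hΦ : Ψ t * Real.exp (H t) ≤ Ψ 0 + F1 0 * I t :=
    image_le_of_deriv_right_le_deriv_boundary hFcont hFder ha hBcont hBder hboundB (right_mem_Icc.2 ht.1)
  -- conclusions
  refine ⟨?_, hHnn t ht, ?_⟩
  · -- (2.15)
    have hpos : 0 < Real.exp (-H t) := Real.exp_pos _
    have h1 : Ψ t = Ψ t * Real.exp (H t) * Real.exp (-H t) := by
      rw [mul_assoc, ← Real.exp_add]; simp
    rw [h1, hF10] at *
    have hc : Ψ1₀ + h 0 * Ψ 0 = h 0 * Ψ 0 + Ψ1₀ := add_comm _ _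
    calc Ψ t * Real.exp (H t) * Real.exp (-H t) ≤ (Ψ 0 + (Ψ1₀ + h 0 * Ψ 0) * I t) * Real.exp (-H t) :=
          mul_le_mul_of_nonneg_right hΦ hpos.le
      _ = (Ψ 0 + (h 0 * Ψ 0 + Ψ1₀) * I t) * Real.exp (-H t) := by rw [hc]
  · -- `t ≤ ∫₀ᵗ e^{2H}`
    have hone : ∀ τ ∈ Icc (0:ℝ) t, (1:ℝ) ≤ Real.exp (2 * H τ) := by
      intro τ hτ
      have := hHnn τ (hsubt hτ)
      exact Real.one_le_exp (by linarith)
    have hint1 : IntervalIntegrable (fun _ : ℝ => (1:ℝ)) volume 0 t := intervalIntegrable_const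
    have hint2 : IntervalIntegrable (fun τ => Real.exp (2 * H τ)) volume 0 t :=
      (hE2cont.mono (by rw [uIcc_of_le ht.1]; exact fun r hr => ⟨hr.1, hr.2.trans_lt htt₁⟩)).intervalIntegrable
    have hmono := intervalIntegral.integral_mono_on ht.1 hint1 hint2 hone
    simpa using hmono

/-! ### D-0026 in-file discharge of the setting, Step 1 (append-only)

`Step_1` — "we need at least local existence of a classical solution" (p. 2), rendered as the C17-type dichotomy
GLOBAL solution ∨ finite maximal time with a MAXIMAL solution (`IsMaximal`) — is the tree's maximal-solution theorem
in the Beale–Kato–Majda class, every `ν ≥ 0`, Euler included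
(`Literature.Analysis.FluidPDE.exists_global_bkmClass_or_blowup`, `NSVorticityBKMMaximal.lean`: Majda–Bertozzi 2002
Thm. 3.4 / Cor. 3.1 / Cor. 3.2 / Thm. 3.6 and Beale–Kato–Majda 1984, all proved in the tree). Nothing else in the file
is touched: the locator of record `Step_6` (last «≥» of (2.11), p. 6, `…Theorems.Chae2005.not_Step_6`), the class and
the compositions are unchanged. -/

/-- **Step 1 holds** (p. 2, the local theory; p. 8 "if the classical solution survives until `T*`"): for `ν ≥ 0` and a
datum of the class, either a global BKM-class solution exists or there is a finite `T > 0` carrying a solution of the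
class on `[0,T)` that no solution of the class from the same datum extends (`IsMaximal`: an extension to `[0,T')`,
`T' > T`, in the class would in particular continue `u` in the class past `T`, `HasSobolevExtensionPast`, which the
maximal solution of `exists_global_bkmClass_or_blowup` excludes).
[cite: MajdaBertozzi2002, Thm. 3.6 and §3.3 (pp. 115–117), Cor. 3.2 (p. 112)] -/
theorem step1_holds : Step_1 := by
  intro ν hν v₀ hv₀
  obtain ⟨hsm, hdiv, hH⟩ := hv₀
  rcases exists_global_bkmClass_or_blowup hν hsm hdiv hH with
    ⟨u, p, hu, hu0, hB, -⟩ | ⟨T, hT, u, p, hu, hu0, hreg, -, hmax, -, -⟩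
  · exact Or.inl ⟨u, p, ⟨hu, hu0, hB⟩⟩
  · refine Or.inr ⟨T, hT, u, p, ⟨hu, hu0, hreg⟩, ?_⟩
    rintro ⟨T', u', p', hTT', hsol', hagree⟩
    exact hmax ⟨T', hTT', u', p', hsol'.isClassical, hsol'.sobolev T hTT', hagree⟩

end Literature.Claims.NS.Chae2005

end

-- WHAT THIS IS NOT: not a claim about NS regularity or blow-up; not a claim about any author beyond the typed
-- locator.
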